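import Summits.QuantumFields.BalabanUV.Beta.KernelWardRelative

/-!
# `BalabanUV.Beta.GAN24.BlockGaugeSummationByParts` — binder row G-an2-4 ∕ (CONV-C), W-slot CT-W, conservation law (C)∕(C)sym AT LEVELS `j ≥ 1`, T2b-(iii) of this lineage's note
# `HOME/b2b-balaban-gan24-formalise-leaf-04/g68/EXIT-FACE-CURRENT-TOWER.md`: **SUMMATION BY PARTS AGAINST THE BLOCK PURE GAUGE** — for ANY 1-form `t` on the fine lattice,
# `Σ'_v Σ_κ t κ v·gaugeWt N y κ v = −Σ_{r ∈ box N} Σ_κ (t κ (N•y + r) − t κ (N•y + r − e_κ))`: the block gauge `gaugeWt N y = d𝟙_{block y}` reads MINUS THE BLOCK SUM OF THE DIVERGENCE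

NOT IN PRINT; OUR BOOKKEEPING ([folklore] finite bookkeeping over an2's `KernelWardRelative.gaugeWt` and an5's `AveragingContours` (`blk`, `off`, `blk_add_off`, `off_mem_box`, `blk_block`);
G-an2-4 formalisation swarm, leaf prover `b2b-balaban-gan24-formalise-leaf-04`, gen 68).  HONEST FRAMING (cell contract, verbatim): «discharging `BetaPertH` makes Bałaban's UV stability
UNCONDITIONAL — a real constructive-QFT result; it is NOT the continuum limit and NOT the Clay problem.»  HONEST DEPENDENCY (verbatim): «continuum YM on T⁴ ⇐ BetaPertH ∧ nine spine estimates
(0/9 proved); BetaPertH ⇐ (D1) ∧ (D4) ∧ CAP+tail; G-an2-4 gates asym, D1 and NE2/3/4.»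

WHY.  `ExitFaceCurrentDivStep.div_faceSlot_current_eq` expresses the level-`(j+1)` divergence at the coarse site `y` as a level-`j` current read against `gaugeWt Lc y`; this file turns that
reading into the block sum of the level-`j` divergence, closing the shape of the induction ℑ_j of the memo.

WHAT ([folklore]; generic `d`, `1 ≤ N`; 0 `def`, 0 cited facts, 0 `def … : Prop`, 0 sorry): `tsum_blk_indicator_mul` (`Σ'_v [blk N v = y]·g v = Σ_{r∈box} g (N•y + toSite r)`),
`tsum_blk_shift_indicator_mul` (`Σ'_v [blk N (v + e_κ) = y]·g v = Σ_{r∈box} g (N•y + toSite r − e_κ)`), **`tsum_sum_mul_gaugeWt_eq_neg_blockSum_div`** (the headline).  Asserts NO value of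
Bałaban's tables; discharges NOTHING of (C)sym ∕ (Q-D) ∕ (Q-D-rate) ∕ «T2Shape» ∕ «T2Drift» ∕ (hW, hWall); NEVER «G-an2-4 closed» as (CONV-C); NOT D1, NOT `BetaPertH`, NOT continuum, NOT Clay.
2026-08-23; no existing file touched.
-/

noncomputable section

open Finset
open scoped BigOperators
open Literature.MathematicalPhysics.QuantumFieldTheory
open Literature.MathematicalPhysics.QuantumFieldTheory.Balaban1983to89
open Literature.MathematicalPhysics.QuantumFieldTheory.Balaban1983to89.Beta
open AffineAveraging (Site box toSite)
open AveragingContours (blk off blk_add_off off_mem_box blk_block)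
open B6BondElimination (unitVec)
open Summit.QuantumFields.BalabanUV.Beta.KernelWardRelative (gaugeWt)

namespace Summit.QuantumFields.BalabanUV.Beta.GAN24.BlockGaugeSummationByParts

variable {d : ℕ} {N : ℕ}

/-- [folklore] `toSite` is injective on offsets. -/
theorem toSite_inj {r r' : Fin (d + 1) → ℕ} (h : toSite r = toSite r') : r = r' := by
  funext i
  have hi := congrFun h i
  simp only [toSite] at hi
  exact_mod_cast hi

/-- [folklore] **THE `tsum` OF A BLOCK-INDICATOR-SUPPORTED FUNCTION IS THE BOX SUM**: `Σ'_v [blk N v = y]·g v = Σ_{r∈box N} g (N•y + toSite r)` (`1 ≤ N`). -/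
theorem tsum_blk_indicator_mul (hN : 1 ≤ N) (y : Site (d + 1)) (g : Site (d + 1) → ℝ) :
    ∑' v : Site (d + 1), (if blk N v = y then (1 : ℝ) else 0) * g v = ∑ r ∈ box (d + 1) N, g ((N : ℤ) • y + toSite r) := by
  classical
  set φ : (Fin (d + 1) → ℕ) → Site (d + 1) := fun r => (N : ℤ) • y + toSite r with hφ
  have hinj : Set.InjOn φ ↑(box (d + 1) N) := by
    intro r _ r' _ h
    simp only [hφ, add_right_inj] at h
    exact toSite_inj h
  have hsupp : ∀ v ∉ (box (d + 1) N).image φ, (if blk N v = y then (1 : ℝ) else 0) * g v = 0 := by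
    intro v hv
    by_cases hb : blk N v = y
    · exfalso
      apply hv
      refine Finset.mem_image.2 ⟨off N v, off_mem_box hN v, ?_⟩
      simp only [hφ]
      rw [← hb]
      exact blk_add_off hN v
    · rw [if_neg hb, zero_mul]
  rw [(hasSum_sum_of_ne_finset_zero hsupp).tsum_eq, Finset.sum_image hinj]
  refine Finset.sum_congr rfl fun r hr => ?_
  simp only [hφ, blk_block y hr, if_true, one_mul]

/-- [folklore] **… SHIFTED**: `Σ'_v [blk N (v + e_κ) = y]·g v = Σ_{r∈box N} g (N•y + toSite r − e_κ)`. -/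
theorem tsum_blk_shift_indicator_mul (hN : 1 ≤ N) (y : Site (d + 1)) (κ : Fin (d + 1)) (g : Site (d + 1) → ℝ) :
    ∑' v : Site (d + 1), (if blk N (v + unitVec κ) = y then (1 : ℝ) else 0) * g v = ∑ r ∈ box (d + 1) N, g ((N : ℤ) • y + toSite r - unitVec κ) := by
  rw [← (Equiv.subRight (unitVec κ)).tsum_eq (fun v : Site (d + 1) => (if blk N (v + unitVec κ) = y then (1 : ℝ) else 0) * g v)]
  simp only [Equiv.subRight_apply, sub_add_cancel]
  exact tsum_blk_indicator_mul hN y (fun v => g (v - unitVec κ))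

/-- [folklore] **SUMMATION BY PARTS AGAINST THE BLOCK PURE GAUGE**: for every `t : Fin (d+1) → Site (d+1) → ℝ` and every coarse site `y` (`1 ≤ N`),
`Σ'_v Σ_κ t κ v·gaugeWt N y κ v = −Σ_{r∈box N} Σ_κ (t κ (N•y + toSite r) − t κ (N•y + toSite r − e_κ))` — minus the block sum of the lattice divergence of `t`. -/
theorem tsum_sum_mul_gaugeWt_eq_neg_blockSum_div (hN : 1 ≤ N) (t : Fin (d + 1) → Site (d + 1) → ℝ) (y : Site (d + 1)) :
    ∑' v : Site (d + 1), ∑ κ : Fin (d + 1), t κ v * gaugeWt N y κ v =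
      -∑ r ∈ box (d + 1) N, ∑ κ : Fin (d + 1), (t κ ((N : ℤ) • y + toSite r) - t κ ((N : ℤ) • y + toSite r - unitVec κ)) := by
  classical
  -- each `κ`-term is a difference of two finitely supported families
  have hA : ∀ κ : Fin (d + 1), HasSum (fun v : Site (d + 1) => (if blk N (v + unitVec κ) = y then (1 : ℝ) else 0) * t κ v)
      (∑ r ∈ box (d + 1) N, t κ ((N : ℤ) • y + toSite r - unitVec κ)) := by
    intro κ
    rw [← tsum_blk_shift_indicator_mul hN y κ (t κ)]
    refine (Summable.hasSum ?_)
    refine summable_of_hasFiniteSupport ?_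
    refine ((box (d + 1) N).image (fun r => (N : ℤ) • y + toSite r - unitVec κ)).finite_toSet.subset ?_
    intro v hv
    rw [Function.mem_support] at hv
    have hb : blk N (v + unitVec κ) = y := by
      by_contra h
      exact hv (by rw [if_neg h, zero_mul])
    simp only [Finset.coe_image, Set.mem_image, Finset.mem_coe]
    refine ⟨off N (v + unitVec κ), off_mem_box hN _, ?_⟩
    rw [← hb, blk_add_off hN (v + unitVec κ), add_sub_cancel_right]
  have hB : ∀ κ : Fin (d + 1), HasSum (fun v : Site (d + 1) => (if blk N v = y then (1 : ℝ) else 0) * t κ v)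
      (∑ r ∈ box (d + 1) N, t κ ((N : ℤ) • y + toSite r)) := by
    intro κ
    rw [← tsum_blk_indicator_mul hN y (t κ)]
    refine (Summable.hasSum ?_)
    refine summable_of_hasFiniteSupport ?_
    refine ((box (d + 1) N).image (fun r => (N : ℤ) • y + toSite r)).finite_toSet.subset ?_
    intro v hv
    rw [Function.mem_support] at hv
    have hb : blk N v = y := by
      by_contra h
      exact hv (by rw [if_neg h, zero_mul])
    simp only [Finset.coe_image, Set.mem_image, Finset.mem_coe]
    exact ⟨off N v, off_mem_box hN _, by rw [← hb]; exact blk_add_off hN v⟩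
  have hκ : ∀ κ : Fin (d + 1), HasSum (fun v : Site (d + 1) => t κ v * gaugeWt N y κ v)
      ((∑ r ∈ box (d + 1) N, t κ ((N : ℤ) • y + toSite r - unitVec κ)) - ∑ r ∈ box (d + 1) N, t κ ((N : ℤ) • y + toSite r)) := by
    intro κ
    refine ((hA κ).sub (hB κ)).congr_fun fun v => ?_
    simp only [gaugeWt]
    ring
  rw [(hasSum_sum fun κ (_ : κ ∈ (Finset.univ : Finset (Fin (d + 1)))) => hκ κ).tsum_eq]
  rw [Finset.sum_congr rfl fun κ _ => (Finset.sum_sub_distrib (s := box (d + 1) N)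
      (f := fun r => t κ ((N : ℤ) • y + toSite r - unitVec κ)) (g := fun r => t κ ((N : ℤ) • y + toSite r))).symm,
    Finset.sum_comm, ← Finset.sum_neg_distrib]
  refine Finset.sum_congr rfl fun r _ => ?_
  rw [← Finset.sum_neg_distrib]
  exact Finset.sum_congr rfl fun κ _ => by ring

end Summit.QuantumFields.BalabanUV.Beta.GAN24.BlockGaugeSummationByParts

end
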